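/-
Copyright: the b2b-balaban T⁴-continuum CRUX team, row NE7b leaf lineage `t4-ne7b-formalise-leaf-06` (gen 161). Project licence.
-/
import Mathlib.Analysis.Seminorm
import Summits.QuantumFields.BalabanUV.T4Continuum.Spine.NE7b.SupEquationTower

/-!
# THE TOWER's RESPONSES AT THE ORIGIN ARE THE CHARTS' OWN SECTIONS: in `…SupEquationTower.tower_eq` every level's chart inverts the
# TRUE linearisation `Eq_k′(0)`, so the branch response at the origin solves the chart's linear system EXACTLY — `Dσ_k(0) = T_k⁻¹∘inl`,
# no smallness — and the linearised composite section is the composite of the charts' linear sections, `𝒮_{k+1} = 𝒮_k∘T_k⁻¹∘inl`;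
# hence EVERY CURRENCY in which the charts' sections are bounded (a `Seminorm` per level — the weighted sup norms `‖·‖_{μ,ρ}` of the
# OWNER's (62)–(65) are the instances) transfers to `𝒮_k = DΦ_k(0)` with the PRODUCT constant `∏_{j<k} N^w_j`
# (row NE7b, node U5c; TOWER BY NAME; [folklore]; any Banach currencies; the per-level letters «in SET's currency» the OWNER g115 located
# (W-ne7bp1-g115-4 ι-3), AT THE ORIGIN — off-origin responses need transversality off `0` and the smallness bootstrap of (63), NOT HERE)

Cell `pub-balaban`, sub-cell `t4`, spine estimate NE7b (`T4WeightBudget.RelWeightBound`; the cell's OWN estimate — NOT PRINTED in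
[Bałaban 1983–89], NOT PROVED).  Crux-route work under `Spine/NE7b/` by a row leaf (`t4-ne7b-formalise-leaf-06` gen 161) under FREEZE
(0)'s crux-prover clause (FILING-CLAIM C-ne7bleaf06g161-7); NOTHING of Bałaban's is named as a Lean object, valued or asserted; no
`T4Continuum/Support` leaf typed; no `def`; zero `sorry`.  Imports: `Mathlib.Analysis.Seminorm` (the second currency) and this lineage's
`…SupEquationTower` (TOWER; through it STEP and SIS).

WHY (located).  The OWNER's (62) `…OneShotChartWeightedRows` bounds ASE's chart inverse `T⁻¹` between WEIGHTED sup spaces at every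
side; (63)–(65) carry the weight through the interacting response by an a-priori bootstrap.  On the tower the question is what the
composite section `𝒮_k = Dσ_0(0)∘⋯∘Dσ_{k−1}(0)` (STL: `= DΦ_k(0)`) inherits.  AT THE ORIGIN the answer is free of analysis: TOWER reads
the level-`k` chart on `(Q_k, P_k∘Eq_k′(0))` — the exact linearisation, not a displayed approximation — and exports `Q_k∘Dσ_k(0) = 1`
((B) at `w = 0`) and, inside the admissibility of `𝒮_{k+1}` ((S) at level `k+1`, `j = k`), `P_k(Eq_k′(0)(Dσ_k(0)v)) = 0`; so
`T_k(Dσ_k(0)v) = (v, 0)` and `Dσ_k(0) = T_k⁻¹∘inl` (§1).  Consequently any seminorm letter `p_k(T_k⁻¹(v,0)) ≤ N^w_k·p_{k+1}(v)` of the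
charts' sections multiplies along `𝒮_{k+1} = 𝒮_k∘T_k⁻¹∘inl` (§2) — the weighted ∕ decay rows of (62) at every side, read as seminorm
bounds for a bounded weight, are such letters.  HONEST: the product `∏_{j<k} N^w_j` is DISPLAYED (no control; each factor is the chart's
weighted norm, `≥ 1` in practice) — it is the honest letter for the STEP-COMPOSED section; a consumer holding the ONE-SHOT chart of the
composite blocking at level `k` replaces it by that chart's single constant through `…SupEquationTowerOneShot` (`Φ_k = σ₀ₖ`, hence
`𝒮_k = DΦ_k(0) = Dσ₀ₖ(0) = T₀ₖ⁻¹∘inl` by §1 — (62) at the composite side, the OWNER's rider (ii)); responses `Dσ_k(w)` for `w ≠ 0` are NOT the chart's sections (the linearisation moves) — their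
second-currency letters need SIS (b)'s transversality off the origin and the bootstrap `(1 − N^w c^w)⁻¹` of (63), the OWNER's road.

WHAT IS PROVED ([folklore]):
* §1 `apply_eq_symm_inl_of_letters` ∕ `eq_symm_comp_inl_of_letters` (any `E F K`): `T h = (Q h, P(A h))`, `Q∘D = 1`,
  `∀ v, P(A(D v)) = 0` ⊢ `D v = T⁻¹(v, 0)`, `D = T⁻¹∘inl`.
* §2 `seminorm_comp_le_prod_of_letters` (`X : ℕ → Type`): `𝒮 0 = 1`, `𝒮 (k+1) = 𝒮 k∘S k`, seminorms `p_k` with `p_k(S_k v) ≤ N^w_k·p_{k+1}(v)`,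
  `0 ≤ N^w_k` ⊢ `p_0(𝒮_k v) ≤ (∏_{j<k} N^w_j)·p_k(v)`.
* §3 **`tower_eq_sections`** — `tower_eq`'s hypotheses VERBATIM ⟹ `∃ σ Eq Eq′ 𝒮 Φ` with TOWER's (R), (S), (B), (C) re-exported for the
  SAME `σ` (the X-SECS chair's G-1), AND at every level **`fderiv ℝ (σ k) 0 = T_k⁻¹∘inl`**, **`𝒮 (k+1) = 𝒮 k∘(T_k⁻¹∘inl)`**, AND — quantified
  AFTER `σ` (one `σ` for ALL admissible weights; the OWNER's rider (i) ∕ the chair's G-2: the content of (62)–(66) is UNIFORMITY over the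
  weights `(μ, ρ)`) — for EVERY per-level seminorm family `p_k` with charts' section letters `p_k(T_k⁻¹(v, 0)) ≤ N^w_k·p_{k+1}(v)`,
  `0 ≤ N^w_k`: **`p 0 (𝒮 k v) ≤ (∏_{j<k} N^w_j)·p k v`**.
* §4 toy (`example`).

NOT HERE (honest): off-origin responses and their second-currency letters ((63)'s bootstrap); the seminorm letters BY VALUE (instances:
(62) `weighted_augInverse` for the free chart at every side, for bounded weights); any control of the product; the `ℓ^∞` instance; (A3) ∕
(A1c); NC-NE7b-α UNRULED; anything of Bałaban's.  BY-NAME EFFECT ON THE WALL: NONE.  NE7b NOT PRINTED ∕ NOT PROVED; spine PROVED 0∕9;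
rung (B)+1 on a FINITE torus — NOT infinite volume, NOT the mass gap, NOT Clay.  HONEST DEPENDENCY: continuum YM on T⁴ ⇐ BetaPertH ∧
nine spine estimates (0∕9 proved); BetaPertH ⇐ (D1) ∧ (D4) ∧ CAP+tail; G-an2-4 gates asym, D1 and NE2∕3∕4.
-/

set_option autoImplicit false

noncomputable section

namespace Summit.QuantumFields.BalabanUV.T4Continuum.NE7b.SupEquationTowerSections

open Set Metric Function
open scoped NNReal
open Summit.QuantumFields.BalabanUV.T4Continuum.NE7b

/-! ## §1. A section of `Q` killed by `P∘A` IS the chart's section -/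

section Chart

variable {E F K : Type*} [NormedAddCommGroup E] [NormedSpace ℝ E] [NormedAddCommGroup F] [NormedSpace ℝ F]
  [NormedAddCommGroup K] [NormedSpace ℝ K]

/-- If the chart reads `T h = (Q h, P(A h))` and `D` is a section of `Q` with `P(A(D v)) = 0`, then `D v = T⁻¹(v, 0)` — no smallness.
[folklore] -/
theorem apply_eq_symm_inl_of_letters (Q : E →L[ℝ] F) (P : E →L[ℝ] K) (A : E →L[ℝ] E) (T : E ≃L[ℝ] F × K)
    (hT : ∀ h, T h = (Q h, P (A h))) {D : F →L[ℝ] E} (hQD : Q.comp D = ContinuousLinearMap.id ℝ F)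
    (hPD : ∀ v, P (A (D v)) = 0) (v : F) : D v = T.symm (v, 0) := by
  have hQ : Q (D v) = v := by simpa using congrArg (fun L : F →L[ℝ] F => L v) hQD
  have h1 : T (D v) = (v, 0) := by rw [hT, hPD, hQ]
  rw [← h1, ContinuousLinearEquiv.symm_apply_apply]

/-- … as an identity of maps: `D = T⁻¹∘inl`. [folklore] -/
theorem eq_symm_comp_inl_of_letters (Q : E →L[ℝ] F) (P : E →L[ℝ] K) (A : E →L[ℝ] E) (T : E ≃L[ℝ] F × K)
    (hT : ∀ h, T h = (Q h, P (A h))) {D : F →L[ℝ] E} (hQD : Q.comp D = ContinuousLinearMap.id ℝ F)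
    (hPD : ∀ v, P (A (D v)) = 0) : D = (T.symm : F × K →L[ℝ] E).comp (ContinuousLinearMap.inl ℝ F K) := by
  ext v
  rw [apply_eq_symm_inl_of_letters Q P A T hT hQD hPD v]
  rfl

end Chart

/-! ## §2. Seminorm letters multiply along the composite section -/

variable {X : ℕ → Type*} {K : ℕ → Type*} [∀ k, NormedAddCommGroup (X k)] [∀ k, NormedSpace ℝ (X k)]
  [∀ k, NormedAddCommGroup (K k)] [∀ k, NormedSpace ℝ (K k)]

/-- **SECOND-CURRENCY LETTERS MULTIPLY**: per-level maps `S_k : X (k+1) →L X k` bounded between seminorms, `p_k(S_k v) ≤ N^w_k·p_{k+1}(v)`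
with `0 ≤ N^w_k`, and the composite `𝒮 0 = 1`, `𝒮 (k+1) = 𝒮 k∘S k` ⊢ `p_0(𝒮_k v) ≤ (∏_{j<k} N^w_j)·p_k(v)`. [folklore] -/
theorem seminorm_comp_le_prod_of_letters (S : ∀ k, X (k + 1) →L[ℝ] X k) (𝒮 : ∀ k, X k →L[ℝ] X 0)
    (h𝒮0 : 𝒮 0 = ContinuousLinearMap.id ℝ (X 0)) (h𝒮 : ∀ k, 𝒮 (k + 1) = (𝒮 k).comp (S k))
    (p : ∀ k, Seminorm ℝ (X k)) {Nw : ℕ → ℝ} (hNw : ∀ k, 0 ≤ Nw k) (hS : ∀ k v, p k (S k v) ≤ Nw k * p (k + 1) v) :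
    ∀ k v, p 0 (𝒮 k v) ≤ (∏ j ∈ Finset.range k, Nw j) * p k v := by
  intro k
  induction k with
  | zero => intro v; rw [h𝒮0, Finset.prod_range_zero, one_mul]; exact le_rfl
  | succ k ih =>
    intro v
    have hP : 0 ≤ ∏ j ∈ Finset.range k, Nw j := Finset.prod_nonneg fun j _ => hNw j
    rw [h𝒮 k, ContinuousLinearMap.comp_apply, Finset.prod_range_succ]
    calc p 0 (𝒮 k (S k v)) ≤ (∏ j ∈ Finset.range k, Nw j) * p k (S k v) := ih _
      _ ≤ (∏ j ∈ Finset.range k, Nw j) * (Nw k * p (k + 1) v) := mul_le_mul_of_nonneg_left (hS k v) hP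
      _ = (∏ j ∈ Finset.range k, Nw j) * Nw k * p (k + 1) v := by ring

/-! ## §3. On the tower -/

/-- **THE TOWER's RESPONSES AT THE ORIGIN ARE THE CHARTS' SECTIONS.**  `tower_eq`'s hypotheses and per-level seminorms `p_k` with the
conclusions (R) (S) (B) (C) for one `σ`, at every level `fderiv ℝ (σ k) 0 = T_k⁻¹∘inl`, `𝒮 (k+1) = 𝒮 k∘(T_k⁻¹∘inl)`, and for every
per-level seminorm family with charts' section letters `p_k(T_k⁻¹(v, 0)) ≤ N^w_k·p_{k+1}(v)` (`0 ≤ N^w_k`), chosen AFTER `σ`: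
`p 0 (𝒮 k v) ≤ (∏_{j<k} N^w_j)·p k v`. [folklore] -/
theorem tower_eq_sections [∀ k, CompleteSpace (X k)] [∀ k, Nontrivial (X k)]
    (Q : ∀ k, X k →L[ℝ] X (k + 1)) (Lp : ∀ k, X (k + 1) →L[ℝ] X k) (P : ∀ k, X k →L[ℝ] K k) (ι : ∀ k, K k →L[ℝ] X k)
    (hPι : ∀ k h, ι k (P k h) = h - Lp k (Q k h)) {CP : ℕ → ℝ} (hCP : ∀ k, ‖P k‖ ≤ CP k)
    (𝒬 : ∀ k, X 0 →L[ℝ] X k) (h𝒬0 : 𝒬 0 = ContinuousLinearMap.id ℝ (X 0)) (h𝒬 : ∀ k, 𝒬 (k + 1) = (Q k).comp (𝒬 k))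
    {Eq₀ : X 0 → X 0} {Eq₀' : X 0 → X 0 →L[ℝ] X 0} (hE0 : Eq₀ 0 = 0)
    {r B M : ℕ → ℝ} (hr0 : ∀ k, 0 ≤ r k) (hM0 : ∀ k, 0 ≤ M k)
    (hE : ∀ x ∈ closedBall (0 : X 0) (r 0), HasFDerivAt Eq₀ (Eq₀' x) x)
    (hB : ∀ x ∈ closedBall (0 : X 0) (r 0), ‖Eq₀' x‖ ≤ B 0)
    (hM : ∀ x ∈ closedBall (0 : X 0) (r 0), ∀ x' ∈ closedBall (0 : X 0) (r 0), ‖Eq₀' x - Eq₀' x'‖ ≤ M 0 * ‖x - x'‖)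
    (T : ∀ k, X k ≃L[ℝ] X (k + 1) × K k) {N c : ℕ → ℝ≥0}
    (hT : ∀ k (𝒮 : X k →L[ℝ] X 0), (𝒬 k).comp 𝒮 = ContinuousLinearMap.id ℝ (X k) →
      (∀ j, j < k → ∀ h, P j (𝒬 j (Eq₀' 0 (𝒮 h))) = 0) → ∀ h, T k h = (Q k h, P k (𝒬 k (Eq₀' 0 (𝒮 h)))))
    (hN : ∀ k (y : X (k + 1) × K k), ‖(T k).symm y‖ ≤ N k * ‖y‖) (hcN : ∀ k, c k < (N k)⁻¹)
    (hc : ∀ k, CP k * M k * r k ≤ (c k : ℝ)) (hr : ∀ k, r (k + 1) < ((N k : ℝ)⁻¹ - c k) * r k)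
    (hBs : ∀ k, ‖Q k‖ * B k * ((N k : ℝ)⁻¹ - c k)⁻¹ ≤ B (k + 1))
    (hMs : ∀ k, ‖Q k‖ * (M k * ((N k : ℝ)⁻¹ - c k)⁻¹ * ((N k : ℝ)⁻¹ - c k)⁻¹ +
      B k * ((((N k : ℝ)⁻¹ - c k)⁻¹) ^ 2 * (CP k * M k) * ((N k : ℝ)⁻¹ - c k)⁻¹)) ≤ M (k + 1)) :
    ∃ (σ : ∀ k, X (k + 1) → X k) (Eq : ∀ k, X k → X k) (Eq' : ∀ k, X k → X k →L[ℝ] X k) (𝒮 : ∀ k, X k →L[ℝ] X 0)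
      (Φ : ∀ k, X k → X 0),
      -- (R) the recursion equations
      Eq 0 = Eq₀ ∧ Eq' 0 = Eq₀' ∧ 𝒮 0 = ContinuousLinearMap.id ℝ (X 0) ∧ Φ 0 = id ∧
      (∀ k, Eq (k + 1) = fun w => Q k (Eq k (σ k w))) ∧
      (∀ k, Eq' (k + 1) = fun w => (Q k).comp ((Eq' k (σ k w)).comp (fderiv ℝ (σ k) w))) ∧
      (∀ k, 𝒮 (k + 1) = (𝒮 k).comp (fderiv ℝ (σ k) 0)) ∧
      (∀ k, Φ (k + 1) = Φ k ∘ σ k) ∧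
      -- (S) the state letters at every level
      (∀ k, Eq k 0 = 0 ∧ (∀ x ∈ closedBall (0 : X k) (r k), HasFDerivAt (Eq k) (Eq' k x) x) ∧
        (∀ x ∈ closedBall (0 : X k) (r k), ‖Eq' k x‖ ≤ B k) ∧
        (∀ x ∈ closedBall (0 : X k) (r k), ∀ x' ∈ closedBall (0 : X k) (r k), ‖Eq' k x - Eq' k x'‖ ≤ M k * ‖x - x'‖) ∧
        (𝒬 k).comp (𝒮 k) = ContinuousLinearMap.id ℝ (X k) ∧
        (∀ j, j < k → ∀ h, P j (𝒬 j (Eq₀' 0 (𝒮 k h))) = 0) ∧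
        Eq' k 0 = (𝒬 k).comp ((Eq₀' 0).comp (𝒮 k))) ∧
      -- (B) the branch letters at every level (TOWER's, re-exported for the SAME `σ`)
      (∀ k, σ k 0 = 0 ∧
        (∀ w ∈ closedBall (0 : X (k + 1)) (((N k : ℝ)⁻¹ - c k) * r k),
          σ k w ∈ closedBall (0 : X k) (r k) ∧ Q k (σ k w) = w ∧ P k (Eq k (σ k w)) = 0 ∧ Eq k (σ k w) = Lp k (Eq (k + 1) w)) ∧
        LipschitzOnWith ((N k)⁻¹ - c k)⁻¹ (σ k) (closedBall (0 : X (k + 1)) (((N k : ℝ)⁻¹ - c k) * r k)) ∧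
        (∀ x ∈ closedBall (0 : X k) (r k), P k (Eq k x) = 0 → σ k (Q k x) = x) ∧
        (∀ w ∈ ball (0 : X (k + 1)) (((N k : ℝ)⁻¹ - c k) * r k), DifferentiableAt ℝ (σ k) w ∧
          ‖fderiv ℝ (σ k) w‖ ≤ ((N k : ℝ)⁻¹ - c k)⁻¹ ∧ (Q k).comp (fderiv ℝ (σ k) w) = ContinuousLinearMap.id ℝ (X (k + 1)))) ∧
      -- (C) the composite letters at every level (TOWER's, re-exported)
      (∀ k, Φ k 0 = 0 ∧ (∀ w ∈ closedBall (0 : X k) (r k), Φ k w ∈ closedBall (0 : X 0) (r 0)) ∧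
        (∀ w ∈ closedBall (0 : X k) (r k), 𝒬 k (Φ k w) = w) ∧
        LipschitzOnWith (∏ j ∈ Finset.range k, ((N j)⁻¹ - c j)⁻¹) (Φ k) (closedBall (0 : X k) (r k)) ∧
        (∀ w ∈ closedBall (0 : X k) (r k), Eq k w = 0 → Eq₀ (Φ k w) = 0)) ∧
      -- THE RESPONSES AT THE ORIGIN ARE THE CHARTS' SECTIONS
      (∀ k, fderiv ℝ (σ k) 0 = ((T k).symm : X (k + 1) × K k →L[ℝ] X k).comp (ContinuousLinearMap.inl ℝ (X (k + 1)) (K k))) ∧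
      (∀ k, 𝒮 (k + 1) = (𝒮 k).comp (((T k).symm : X (k + 1) × K k →L[ℝ] X k).comp (ContinuousLinearMap.inl ℝ (X (k + 1)) (K k)))) ∧
      -- the second-currency product letter, for EVERY per-level seminorm family AFTER `σ` is fixed (one `σ` for all admissible weights):
      -- charts' section letters `p_k(T_k⁻¹(v, 0)) ≤ N^w_k·p_{k+1}(v)` with `0 ≤ N^w_k` ⟹ `p_0(𝒮_k v) ≤ (∏_{j<k} N^w_j)·p_k(v)`
      (∀ (p : ∀ k, Seminorm ℝ (X k)) (Nw : ℕ → ℝ), (∀ k, 0 ≤ Nw k) →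
        (∀ k (v : X (k + 1)), p k ((T k).symm (v, 0)) ≤ Nw k * p (k + 1) v) →
        ∀ k (v : X k), p 0 (𝒮 k v) ≤ (∏ j ∈ Finset.range k, Nw j) * p k v) := by
  obtain ⟨σ, Eq, Eq', 𝒮, Φ, hE0', hE0'', h𝒮0, hΦ0, hEs, hE's, h𝒮s, hΦs, hS, hBr, hC⟩ :=
    SupEquationTower.tower_eq Q Lp P ι hPι hCP 𝒬 h𝒬0 h𝒬 hE0 hr0 hM0 hE hB hM T hT hN hcN hc hr hBs hMs
  -- at every level: the response at the origin is the chart's section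
  have hsec : ∀ k, fderiv ℝ (σ k) 0 =
      ((T k).symm : X (k + 1) × K k →L[ℝ] X k).comp (ContinuousLinearMap.inl ℝ (X (k + 1)) (K k)) := by
    intro k
    obtain ⟨-, -, -, -, h𝒮k, hadm, hlin⟩ := hS k
    obtain ⟨-, -, -, -, -, hadm', -⟩ := hS (k + 1)
    have h0 : (0 : X (k + 1)) ∈ ball (0 : X (k + 1)) (((N k : ℝ)⁻¹ - c k) * r k) :=
      mem_ball_self (lt_of_le_of_lt (hr0 (k + 1)) (hr k))
    obtain ⟨-, -, hQD⟩ := (hBr k).2.2.2.2 0 h0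
    -- the chart reads `(Q_k, P_k ∘ Eq_k′(0))` on the admissible section `𝒮 k`
    have hTk : ∀ h, T k h = (Q k h, P k ((Eq' k 0) h)) := fun h => by rw [hT k (𝒮 k) h𝒮k hadm h, hlin]; rfl
    -- transversality at the origin, from the admissibility of `𝒮 (k+1) = 𝒮 k ∘ Dσ_k(0)` at `j = k`
    have hPD : ∀ v, P k ((Eq' k 0) (fderiv ℝ (σ k) 0 v)) = 0 := fun v => by
      have h1 := hadm' k (Nat.lt_succ_self k) v
      rw [h𝒮s k] at h1
      rw [hlin]
      exact h1
    exact eq_symm_comp_inl_of_letters (Q k) (P k) (Eq' k 0) (T k) hTk hQD hPD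
  have h𝒮s' : ∀ k, 𝒮 (k + 1) =
      (𝒮 k).comp (((T k).symm : X (k + 1) × K k →L[ℝ] X k).comp (ContinuousLinearMap.inl ℝ (X (k + 1)) (K k))) :=
    fun k => by rw [h𝒮s k, hsec k]
  refine ⟨σ, Eq, Eq', 𝒮, Φ, hE0', hE0'', h𝒮0, hΦ0, hEs, hE's, h𝒮s, hΦs, hS, hBr, hC, hsec, h𝒮s', fun p Nw hNw hTw => ?_⟩
  exact seminorm_comp_le_prod_of_letters
    (fun k => ((T k).symm : X (k + 1) × K k →L[ℝ] X k).comp (ContinuousLinearMap.inl ℝ (X (k + 1)) (K k))) 𝒮 h𝒮0 h𝒮s' p hNw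
    (fun k v => by simpa using hTw k v)

/-! ## §4. Toy -/

/-- Toy: §1 on `ℝ` with `Q = T = id`-like data — if `T h = (h, 0)` (so `Q = 1`, `P∘A = 0`) then the section `D = 1` is `T⁻¹∘inl`. -/
example (T : ℝ ≃L[ℝ] ℝ × ℝ) (hT : ∀ h, T h = ((ContinuousLinearMap.id ℝ ℝ) h, (0 : ℝ →L[ℝ] ℝ) ((ContinuousLinearMap.id ℝ ℝ) h)))
    (v : ℝ) : (ContinuousLinearMap.id ℝ ℝ) v = T.symm (v, 0) :=
  apply_eq_symm_inl_of_letters (ContinuousLinearMap.id ℝ ℝ) (0 : ℝ →L[ℝ] ℝ) (ContinuousLinearMap.id ℝ ℝ) T hT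
    (D := ContinuousLinearMap.id ℝ ℝ) rfl (fun _ => rfl) v

end Summit.QuantumFields.BalabanUV.T4Continuum.NE7b.SupEquationTowerSections

end
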